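import Literature.AlgebraicGeometry.HodgeTheory.ComplexAtiyahPower
import HarnessLib

/-!
# The argument `(x · ι_K) · At(K)^q` of a semiregularity map for complexes: naturality along
# intertwined classes and the single-complex anchor `E[0]`

PROMOTED LITERATURE COPY (librarian protocol (b); DEFREQ-CoherentISemiregular, cell pub-hsemireg) of the generic, conjecture-free
`Summits/Ventures/HSemireg/SigmaArgument.lean` — namespace now `Literature.AlgebraicGeometry.HodgeTheory`, names kept; cell words (seats, ventures) = provenance.

Cell `pub-hsemireg`, general-structure seat gs-g4; sequel to `ComplexAtiyahPower.lean` (gs-g4) and `ComplexAtiyahClass.lean`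
(p3: `extMulAtiyahPower X K q x = (x · ι_K) · At(K)^q`, the class a future `σ_q` for strictly perfect complexes traces —
step (A1) of p3's K2-ANCHOR-PLAN). HONEST FRAMING: infrastructure on the tree's REAL carriers only — NOT a door, NOT a
named fact, NOT a statement about any variety, NOT a «K2 result»; nothing here says HC, HC_CM or HC_AV is proved.

CONTENTS (all proved; Mathlib + tree only). For an `S`-scheme `X`, any `HasDerivedCategory` instance:
* **`extMulAtiyahPower_single`** — for a MODULE `E` and `x ∈ Ext²(E, E)`: p3's class of the single complex `E[0]` at
  `x.hom`, pushed along `(E[0]) ⊗ Ω^q ≅ (E ⊗ Ω^q)[0]`, IS the image in the derived category of the tree's module class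
  `(x · ι_E) · At(E)^q ∈ Ext^{q+2}(E, E ⊗ Ω^q)` — literally the argument of `sigmaHigher hE q x` (`sigmaHigher_apply`,
  `HodgeTheory/SemiregularityHigherSigma.lean`); from `complexAtiyahPower_single`, `toTwistHodgeZeroC_single`, Mathlib
  `Ext.comp_hom` / `Ext.mk₀_hom`;
* **`extMulAtiyahPower_naturality`** — for a chain map `f : K₁ → K₂` and degree-`2` classes `x`, `x'` with `x · f = f · x'`
  (conjugates along an isomorphism; transports along a quasi-isomorphism):
  `((x · ι) · At(K₁)^q) · (f ⊗ 1_{Ω^q}) = f · ((x' · ι) · At(K₂)^q)` — the complex-level input of the conjugation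
  invariance of `σ_q` (module level: `sigmaHigher_conj`, `HigherSigmaOfIso.lean`); from `complexAtiyahPowerFrom_naturality`;
* `extMulAtiyahPower_add`, `extMulAtiyahPower_zero` — additivity in the class (so a `σ_q` built on it is a group map).

## References
* R.-O. Buchweitz, H. Flenner, *A semiregularity map for modules and applications to deformations*, Compositio
  Math. 137 (2003), Def. 4.1, §4 (`At^k`). [BuchweitzFlenner2003]
-/

noncomputable section

open CategoryTheory CategoryTheory.Limits CategoryTheory.Abelian AlgebraicGeometry Opposite

namespace Literature.AlgebraicGeometry.HodgeTheory

open Literature.AlgebraicGeometry.Modules Literature.AlgebraicGeometry.Motives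
open Literature.AlgebraicGeometry.HodgeTheory
open DerivedCategory

universe w' u

variable {S : Type u} [CommRing S] {X : Over (Spec (CommRingCat.of S))}

section SigmaArgument

open HomologicalComplex

variable [HasDerivedCategory.{w'} X.left.Modules] (q : ℕ) (E : X.left.Modules)

/-- **(A1)**: for a module `E` and `x ∈ Ext²(E, E)`, p3's argument-of-`σ_q` class of the single complex `E[0]` at
`x.hom`, pushed along `(E[0]) ⊗ Ω^q ≅ (E ⊗ Ω^q)[0]`, is the image in the derived category of the tree's module class
`(x · ι_E) · At(E)^q ∈ Ext^{q+2}(E, E ⊗ Ω^q)` (the argument of `sigmaHigher`, `sigmaHigher_apply`).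
[cite: BuchweitzFlenner2003, Def. 4.1] -/
theorem extMulAtiyahPower_single (x : Ext E E 2) :
    (extMulAtiyahPower X ((single X.left.Modules (ComplexShape.up ℤ) 0).obj E) q x.hom).comp
        (ShiftedHom.mk₀ (0 : ℤ) rfl (Q.map (twistHodgeComplexSingleIso q E).hom)) (zero_add _) =
      ((x.comp (Ext.mk₀ (toTwistHodgeZero E)) (add_zero 2)).comp (atiyahClassPower E q) (add_comm 2 q)).hom := by
  rw [Ext.comp_hom, Ext.comp_hom, Ext.mk₀_hom, extMulAtiyahPower, shiftedHom_comp_comp_mk₀, complexAtiyahPower_single]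
  erw [← shiftedHom_comp_mk₀_comp]
  rw [shiftedHom_comp_comp_mk₀, ShiftedHom.mk₀_comp_mk₀, ← Functor.map_comp, toTwistHodgeZeroC_single]
  rfl

omit E in
variable {K₁ K₂ : CochainComplex X.left.Modules ℤ} in
/-- **The argument of `σ_q` is natural along intertwined classes**: if `f : K₁ → K₂` is a chain map and
`x · f = f · x'` for degree-`2` classes `x` on `K₁`, `x'` on `K₂` (e.g. `x = e ≫ x' ≫ e⁻¹` for an isomorphism, or the
transport of `x'` along a quasi-isomorphism), then `((x · ι) · At(K₁)^q) · (f ⊗ 1_{Ω^q}) = f · ((x' · ι) · At(K₂)^q)` — the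
complex-level input of the conjugation invariance of `σ_q` (module level: `sigmaHigher_conj`). [cite: BuchweitzFlenner2003, §4] -/
theorem extMulAtiyahPower_naturality (f : K₁ ⟶ K₂) (x : ShiftedHom (Q.obj K₁) (Q.obj K₁) (2 : ℤ))
    (x' : ShiftedHom (Q.obj K₂) (Q.obj K₂) (2 : ℤ))
    (h : x.comp (ShiftedHom.mk₀ (0 : ℤ) rfl (Q.map f)) (zero_add 2) =
      (ShiftedHom.mk₀ (0 : ℤ) rfl (Q.map f)).comp x' (add_zero 2)) :
    (extMulAtiyahPower X K₁ q x).comp (ShiftedHom.mk₀ (0 : ℤ) rfl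
        (Q.map (((twistHodgeFunctor X q).mapHomologicalComplex _).map f))) (zero_add _) =
      (ShiftedHom.mk₀ (0 : ℤ) rfl (Q.map f)).comp (extMulAtiyahPower X K₂ q x') (add_zero _) := by
  rw [extMulAtiyahPower_eq_comp, extMulAtiyahPower_eq_comp, shiftedHom_comp_comp_mk₀, complexAtiyahPowerFrom_naturality,
    ← shiftedHom_comp_mk₀_comp, h, shiftedHom_mk₀_comp_comp]

omit E in
variable (K : CochainComplex X.left.Modules ℤ) in
/-- The argument of `σ_q` is additive in the class: `((x + x') · ι) · At^q = (x · ι) · At^q + (x' · ι) · At^q`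
(pre-composition of shifted morphisms is additive, Mathlib `ShiftedHom.add_comp`). [cite: BuchweitzFlenner2003, Def. 4.1] -/
theorem extMulAtiyahPower_add (x x' : ShiftedHom (Q.obj K) (Q.obj K) (2 : ℤ)) :
    extMulAtiyahPower X K q (x + x') = extMulAtiyahPower X K q x + extMulAtiyahPower X K q x' := by
  rw [extMulAtiyahPower, extMulAtiyahPower, extMulAtiyahPower, ShiftedHom.add_comp, ShiftedHom.add_comp]

omit E in
variable (K : CochainComplex X.left.Modules ℤ) in
/-- The argument of `σ_q` vanishes on the zero class. [cite: BuchweitzFlenner2003, Def. 4.1] -/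
theorem extMulAtiyahPower_zero : extMulAtiyahPower X K q 0 = 0 := by
  rw [extMulAtiyahPower, ShiftedHom.zero_comp, ShiftedHom.zero_comp]

end SigmaArgument

end Literature.AlgebraicGeometry.HodgeTheory

end
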